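import Summits.HubbardSuperconductivity.HubbardLadder.Targets
import Summits.HubbardSuperconductivity.HubbardLadder.R3R4Props
import Literature.MathematicalPhysics.QuantumLattice.HeisenbergOrderNeelShortRange
import Literature.MathematicalPhysics.QuantumLattice.HeisenbergOrderNeelProofs
import Literature.MathematicalPhysics.QuantumLattice.HeisenbergOrderEvenTorusLROProofs
import HarnessLib

/-!
# HubbardLadder — links: certificate shapes and Literature criteria ⟹ the typed cell targets

HONEST FRAMING: ladder R1–R4 with certified numbers; no claim on H/H₀.

The cell's targets `H₀`, `H` are typed as `@[conjecture]` `Prop`s in `Targets.lean`; the certificate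
shapes of rungs R3/R4 and the two thermodynamic-limit chains are in `R3R4Props.lean`; the printed
Kennedy–Lieb–Shastry short-range criterion for Néel order is the Literature theorem
`neelOrder_spinHalf_square_of_shortRangeCorr_anderson` (`HeisenbergOrderNeelShortRange.lean`).
This file only WIRES them together (item M4 of the cell's `R4-MEMO.md`): every statement is an
implication "certificate / certified hypotheses ⟹ target", and NO certificate of any of these
shapes exists today — nothing here claims `H₀` or `H`.

* `dWaveOrderParamSq_eq_pairFieldDensity` — the `k`-th term (`k ≥ 1`) of the order-parameter
  sequence of `Targets.lean` is the pair-field density `p_d(2k; ψ_{2k})` of `R3R4Props.lean`.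
* `noDWaveOrderPureU8Eighth_of_vanishingCeilingCert` — an R4⁻ certificate
  `VanishingPairFieldCeilingCert (pureHubbard 8) (electronNumber (1/8))` proves H⁻
  (`NoDWaveOrderPureU8Eighth`).
* `dWaveOrderTPrimeQuarterU8Eighth_of_uniformLowerCert`,
  `dWaveOrderTPrimeFifthU8Eighth_of_uniformLowerCert` — an R4⁺ certificate
  `UniformPairFieldLowerCert (fun L => hubbardTorusTT' L 1 t' 8) (electronNumber (1/8))` at
  `t' = -1/4` (resp. `-1/5`) proves H⁺ at that `t'`.
* `hubbardDichotomyU8Eighth_of_certs` — both certificates prove H (`HubbardDichotomyU8Eighth`).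
* `neelOrderSpinHalfSquare_of_shortRangeCorr` — certified eventual bounds `c ≤ ḡ_{2k+2}(N)`,
  `𝓡_{2k+2}(N) ≤ ρ` with `ρ < 4c` (KLS 1988 eqs. (10)–(11), Table I, Anderson's energy bound
  built in) prove H₀ (`NeelOrderSpinHalfSquare`).
* `neelOrderSpinHalfSquare_of_uniform` — the quantitative target `NeelOrderSpinHalfSquareUniform`
  implies `NeelOrderSpinHalfSquare` (a `k`-uniform floor under `m_s²(2k)` is a positive `liminf`;
  the sequence is bounded above by `neelSum_le`).

References: Qin et al. PRX 10 (2020) 031016 §IV; Xu et al. Science 384 (2024) eadh7691;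
Kennedy–Lieb–Shastry, J. Stat. Phys. 53 (1988) 1019, eqs. (10)–(11) and Table I;
Dyson–Lieb–Simon, J. Stat. Phys. 18 (1978) 335, §1 eq. (1.4).
-/

noncomputable section

namespace Summit.HubbardSuperconductivity.HubbardLadder

open Matrix Finset Filter Literature.Probability.LatticeModels
  Literature.MathematicalPhysics.QuantumLattice
open scoped ComplexOrder Topology

/-! ### H: the order-parameter sequence and the R4 certificate links -/

/-- For `k ≥ 1` the `k`-th term of `Targets.lean`'s order-parameter sequence is the pair-field
density of `R3R4Props.lean`: `dWaveOrderParamSq ψ k = p_d(2k; ψ_{2k})`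
(`lroSeq_succ_eq_pairFieldDensity`). [cite: Scalapino1995, §2 eq. (2.4)] -/
theorem dWaveOrderParamSq_eq_pairFieldDensity (ψ : ∀ L, Fock (Orb (FermionTorus 2 L))) {k : ℕ}
    (hk : 1 ≤ k) : dWaveOrderParamSq ψ k = pairFieldDensity (2 * k) (ψ (2 * k)) := by
  obtain ⟨m, hm⟩ : ∃ m, 2 * k = m + 1 := ⟨2 * k - 1, by omega⟩
  unfold dWaveOrderParamSq
  rw [hm]
  exact lroSeq_succ_eq_pairFieldDensity ψ m

/-- **R4⁻ link.** A vanishing ceiling certificate for the pure model at `(U, δ) = (8, 1/8)` proves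
the cell target H⁻ `NoDWaveOrderPureU8Eighth` (`VanishingPairFieldCeilingCert.tendsto_zero_lroSeq`;
`pureHubbard 8 L = hubbardTorus 2 L 1 8` and `electronNumber (1/8) L = 2⌊(7/8)L²/2⌋` by `rfl`).
No such certificate exists; this is the edge. [cite: QinEtAl2020, §IV p. 11] -/
theorem noDWaveOrderPureU8Eighth_of_vanishingCeilingCert
    (cert : VanishingPairFieldCeilingCert (pureHubbard 8) (electronNumber (1 / 8))) :
    NoDWaveOrderPureU8Eighth := by
  intro N ψ hNψ
  have hψ : ∀ L, Even L → star (ψ L) ⬝ᵥ ψ L = 1 ∧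
      IsGroundStateInSector (pureHubbard 8 L) (electronNumber (1 / 8) L) 0 (ψ L) := by
    intro L hL
    obtain ⟨hN, h1, hgs⟩ := hNψ L hL
    rw [hN] at hgs
    exact ⟨h1, hgs⟩
  exact cert.tendsto_zero_lroSeq ψ hψ

/-- **R4⁺ link, any `t'`.** A uniform lower certificate for the `t–t'` model at `U = 8`, `δ = 1/8`
gives Scalapino pair-field LRO for every admissible ground-state sequence of `hubbardTorusTT' L 1 t' 8`
(`UniformPairFieldLowerCert.hasLongRangeOrder`). [cite: XuEtAl2024, abstract and p. 2] -/
theorem hasLongRangeOrder_tPrime_of_uniformLowerCert (t' : ℝ)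
    (cert : UniformPairFieldLowerCert (fun L => hubbardTorusTT' L 1 t' 8) (electronNumber (1 / 8)))
    (N : ℕ → ℕ) (ψ : ∀ L, Fock (Orb (FermionTorus 2 L)))
    (hNψ : ∀ L, Even L → N L = 2 * ⌊(1 - 1 / 8) * (L : ℝ) ^ 2 / 2⌋₊ ∧ star (ψ L) ⬝ᵥ ψ L = 1 ∧
        IsGroundStateInSector (hubbardTorusTT' L 1 t' 8) (N L) 0 (ψ L)) :
    HasLongRangeOrder (fun k => halfOpenBox 2 (2 * k))
      (fun k => torusPullback (pairFieldCorr dWaveFormFactor ψ) (2 * k)) := by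
  refine cert.hasLongRangeOrder ψ fun L hL => ?_
  obtain ⟨hN, h1, hgs⟩ := hNψ L hL
  rw [hN] at hgs
  exact ⟨h1, hgs⟩

/-- **R4⁺ link at the headline locus `t'/t = -1/4`**: a uniform lower certificate proves the cell
target `DWaveOrderTPrimeQuarterU8Eighth`. No such certificate exists; this is the edge.
[cite: XuEtAl2024, abstract and p. 2] -/
theorem dWaveOrderTPrimeQuarterU8Eighth_of_uniformLowerCert
    (cert : UniformPairFieldLowerCert (fun L => hubbardTorusTT' L 1 (-1 / 4) 8)
      (electronNumber (1 / 8))) :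
    DWaveOrderTPrimeQuarterU8Eighth :=
  fun N ψ hNψ => hasLongRangeOrder_tPrime_of_uniformLowerCert (-1 / 4) cert N ψ hNψ

/-- **R4⁺ link at the published locus `t'/t = -1/5`** (Xu et al. 2024): a uniform lower certificate
proves `DWaveOrderTPrimeFifthU8Eighth`. No such certificate exists; this is the edge.
[cite: XuEtAl2024, abstract and p. 2] -/
theorem dWaveOrderTPrimeFifthU8Eighth_of_uniformLowerCert
    (cert : UniformPairFieldLowerCert (fun L => hubbardTorusTT' L 1 (-1 / 5) 8)
      (electronNumber (1 / 8))) :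
    DWaveOrderTPrimeFifthU8Eighth :=
  fun N ψ hNψ => hasLongRangeOrder_tPrime_of_uniformLowerCert (-1 / 5) cert N ψ hNψ

/-- **H from two R4 certificates**: a vanishing ceiling certificate for the pure model and a
uniform lower certificate at `t' = -1/4`, both at `(U, δ) = (8, 1/8)`, prove the dichotomy
`HubbardDichotomyU8Eighth`. Neither exists; this is the edge. [cite: QinEtAl2020, §IV p. 11]
[cite: XuEtAl2024, abstract] -/
theorem hubbardDichotomyU8Eighth_of_certs
    (cneg : VanishingPairFieldCeilingCert (pureHubbard 8) (electronNumber (1 / 8)))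
    (cpos : UniformPairFieldLowerCert (fun L => hubbardTorusTT' L 1 (-1 / 4) 8)
      (electronNumber (1 / 8))) :
    HubbardDichotomyU8Eighth :=
  ⟨noDWaveOrderPureU8Eighth_of_vanishingCeilingCert cneg,
    dWaveOrderTPrimeQuarterU8Eighth_of_uniformLowerCert cpos⟩

/-! ### H₀: the Kennedy–Lieb–Shastry short-range criterion and the quantitative form -/

/-- **H₀ from certified short-range staggered sums (KLS 1988 Table I route).** Eventual certified
bounds along the even tori `L = 2k+2` of the spin-½ square-lattice antiferromagnet (`J = 1`
normalisation): `c ≤ ḡ_L(N)` (short-range staggered axis sums, `heisStagShortRangeSum`),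
`𝓡_L(N) ≤ ρ` (the KLS Riemann sums, `klsShortRangeRiemannSum`) with `ρ < 4c` prove the cell target
`NeelOrderSpinHalfSquare` — the Literature theorem
`neelOrder_spinHalf_square_of_shortRangeCorr_anderson` quantified over `J > 0`. The numbers `c, ρ`
are the cell's to certify (none certified today; indicative thresholds in `NEEL-RIGOROUS.md` §4).
[cite: KLS1988JSP, eqs. (10)–(11), Table I] -/
theorem neelOrderSpinHalfSquare_of_shortRangeCorr (N : ℕ) {c ρ : ℝ}
    (hcorr : ∀ᶠ k : ℕ in atTop, c ≤ heisStagShortRangeSum (d := 2) N (2 * k + 2) 1)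
    (hR : ∀ᶠ k : ℕ in atTop, klsShortRangeRiemannSum (d := 2) N (2 * k + 2) ≤ ρ)
    (hgap : ρ < 4 * c) : NeelOrderSpinHalfSquare :=
  fun _J hJ => neelOrder_spinHalf_square_of_shortRangeCorr_anderson N hcorr hR hgap hJ

/-- **The quantitative H₀ implies H₀.** A `k`-uniform floor `c > 0` under `m_s²(2k)`, `k ≥ 1`
(`NeelOrderSpinHalfSquareUniform`) gives a positive `liminf` of the Néel sums along the even tori,
i.e. `NeelOrderSpinHalfSquare` (`hasStaggeredEvenTorusLRO_iff_holds`; the sums are bounded above by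
`neelSum_le`, which keeps the real `liminf` honest). [cite: DysonLiebSimonJSP1978, §1 eq. (1.4)] -/
theorem neelOrderSpinHalfSquare_of_uniform (h : NeelOrderSpinHalfSquareUniform) :
    NeelOrderSpinHalfSquare := by
  obtain ⟨c, hc, hbound⟩ := h
  intro J hJ
  rw [hasStaggeredEvenTorusLRO_iff_holds]
  refine hc.trans_le (le_liminf_of_le ?_ (Eventually.of_forall fun k => ?_))
  · exact isCoboundedUnder_ge_of_le atTop fun k => by
      haveI : NeZero (2 * k + 2) := ⟨by omega⟩
      exact neelSum_le (d := 2) 1 (2 * k + 2) hJ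
  · have hk := hbound J hJ (k + 1) (by omega)
    have h2 : 2 * (k + 1) = 2 * k + 1 + 1 := by ring
    rw [h2, neelOrderParamSq] at hk
    show c ≤ (∑ x : TorusSite 2 (2 * k + 1 + 1), ∑ y : TorusSite 2 (2 * k + 1 + 1),
        (-1 : ℝ) ^ (∑ i, (x i).val) * (-1) ^ (∑ i, (y i).val) *
          groundStateSpinCorrTorus (d := 2) (2 * k + 1 + 1) 1 J x y) /
        ((2 * k + 1 + 1 : ℕ) : ℝ) ^ (2 * 2)
    simpa using hk

end Summit.HubbardSuperconductivity.HubbardLadder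

end
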